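import Mathlib
import Summits.AtomisticToContinuum.HydrodynamicLimit.Theorems.ImplosionDichotomyDenseExcursionSonicCavityDefs
import Summits.AtomisticToContinuum.HydrodynamicLimit.Theorems.ImplosionDichotomyDenseExcursionPackingAnalyticDefs

/-!
# The large-real-`Λ` resolvent as a corollary of the cavity resolvent
# (crux `DenseExcursion`, stmt-AtomisticToContinuum-12586, line `sonic-cavity-renewal`, stub `stub_largeRealResolvent`)

Proof file (`--supports stmt-AtomisticToContinuum-12586`) for the registered stub `stub_largeRealResolvent` of the merged
skeleton `Cruxes/DenseExcursion/Lines/sonic_cavity_renewal.lean` (v5):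

  `∀ r W S, BoxPackage r W S → RealBound r W S → CavityResolvent r W S → LargeRealResolvent r W S`.

**Mathematics.** Let `Λ₁ ∈ (6(r−1), 9(r−1))` be the package rate of `BoxPackage` (with its smooth mode), and let `C` be the
constant of `CavityResolvent` at `Λ₁`. Put `Λ₀ := 101 + |Λ₁| + |r|`. For real `Λ ≥ Λ₀`:

* (i) no smooth radial mode at `(Λ : ℂ)`: `RealBound` gives `Λ = Re Λ ≤ boxSide = 100 < 101 ≤ Λ`;
* (ii) given a real centre-regular source `(f₁, f₂)` (stated through the complex vocabulary `IsRegularPair` by coercion), its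
  weighted sup `|f₁ y| + eʸ |f₂ y|` on `y ≤ 1` is finite (`weightedSup_of_isRegularPair`): the radial field
  `F₁ y = f₁(log ‖y‖) y` is `C^∞` on `ℝ³`, hence Lipschitz with constant `K = sup ‖F₁′‖` on the closed ball of radius `e`
  (mean value inequality), and it is ODD off the origin, so `2 |f₁(log ‖y‖)| ‖y‖ = ‖F₁ y − F₁ (−y)‖ ≤ 2K‖y‖`, i.e. `|f₁ x| ≤ K`
  for `x ≤ 1`; the scalar field `G₁ y = ‖y‖ f₂(log ‖y‖)` is continuous, hence bounded by `K′` on the same ball, i.e.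
  `eˣ |f₂ x| ≤ K′` for `x ≤ 1`. The four constraints `Re Λ ≥ −1/5`, `‖Λ‖, ‖Λ − Λ₁‖, ‖Λ − r‖ ≥ 1/20` hold since `Λ ≥ 101`,
  `Λ − Λ₁ ≥ 1`, `Λ − r ≥ 1`. So `CavityResolvent` yields a smooth centre-regular complex solution `(ŵ, ŝ)` of
  `(Λ − L)(ŵ, ŝ) = (f₁, f₂)`; its componentwise REAL PART `(u₁, u₂) = (Re ŵ, Re ŝ)` is again smooth and centre-regular
  (`isRegularPair_re`: same real fields, zero imaginary fields) and solves the same equations, because `Λ`, the coefficients of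
  `L = (linW, linS)` and the data are real and `Re` commutes with `d/dx` (`deriv_ofReal_re`, `re_solves`).

NOT here: `BoxPackage`, `RealBound`, `CavityResolvent` themselves (hypotheses; other stubs of the line).
-/

noncomputable section

open Set Filter Topology
open scoped ContDiff

namespace Summit.AtomisticToContinuum.HydrodynamicLimit.Theorems.PackingAnalyticImplosion

open Literature.MathematicalPhysics.KineticTheory (V3)
open Summit.AtomisticToContinuum.HydrodynamicLimit.Theorems.KidderKnobMelnikov (norm_smul_unitVec)
open Summit.AtomisticToContinuum.HydrodynamicLimit.Theorems.R2OneModeTwoConditions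
open Summit.AtomisticToContinuum.HydrodynamicLimit.Theorems.SonicCavityRenewal

/-! ## The weighted sup of a real centre-regular pair is finite on `x ≤ 1` -/

/-- A REAL centre-regular pair `(f₁, f₂)` has finite weighted sup `|f₁ x| + eˣ |f₂ x|` on the core + margin `x ≤ 1`: the odd
smooth radial field `F₁ y = f₁(log ‖y‖) y` is Lipschitz on the closed ball of radius `e` (mean value inequality with
`K = sup ‖F₁′‖`), whence `|f₁ x| ≤ K`; the continuous scalar field `G₁ y = ‖y‖ f₂(log ‖y‖)` is bounded there, whence
`eˣ |f₂ x| ≤ K′`. [folklore] -/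
theorem weightedSup_of_isRegularPair {f₁ f₂ : ℝ → ℝ}
    (h : IsRegularPair (fun x => (f₁ x : ℂ)) (fun x => (f₂ x : ℂ))) :
    ∃ N : ℝ, ∀ y, y ≤ 1 → ‖(f₁ y : ℂ)‖ + Real.exp y * ‖(f₂ y : ℂ)‖ ≤ N := by
  obtain ⟨-, -, F₁, F₂, G₁, G₂, hF₁, -, hG₁, -, hFG⟩ := h
  have hB : IsCompact (Metric.closedBall (0 : V3) (Real.exp 1)) := isCompact_closedBall _ _
  obtain ⟨K, hK⟩ := hB.exists_bound_of_continuousOn ((hF₁.continuous_fderiv (by simp)).continuousOn)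
  obtain ⟨K', hK'⟩ := hB.exists_bound_of_continuousOn hG₁.continuous.continuousOn
  refine ⟨K + K', fun x hx => ?_⟩
  -- the point `y = eˣ e₀` of the closed ball of radius `e`, and its antipode
  set y : V3 := Real.exp x • (EuclideanSpace.single 0 1 : V3) with hy_def
  have hny : ‖y‖ = Real.exp x := norm_smul_unitVec (Real.exp_pos x).le
  clear_value y
  have hy0 : y ≠ 0 := norm_pos_iff.1 (by rw [hny]; exact Real.exp_pos x)
  have hyB : y ∈ Metric.closedBall (0 : V3) (Real.exp 1) := by
    rw [Metric.mem_closedBall, dist_zero_right, hny]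
    exact Real.exp_le_exp.2 hx
  have hnyB : -y ∈ Metric.closedBall (0 : V3) (Real.exp 1) := by
    rw [Metric.mem_closedBall, dist_zero_right, norm_neg, hny]
    exact Real.exp_le_exp.2 hx
  -- the radial fields along the ray
  have hFy : F₁ y = f₁ x • y := by
    have h1 := (hFG y hy0).1
    rw [hny, Real.log_exp, Complex.ofReal_re] at h1
    exact h1.symm
  have hFny : F₁ (-y) = -(f₁ x • y) := by
    have h1 := (hFG (-y) (neg_ne_zero.2 hy0)).1
    rw [norm_neg, hny, Real.log_exp, Complex.ofReal_re, smul_neg] at h1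
    exact h1.symm
  have hGy : G₁ y = Real.exp x * f₂ x := by
    have h1 := (hFG y hy0).2.2.1
    rw [hny, Real.log_exp, Complex.ofReal_re] at h1
    exact h1.symm
  -- `|f₁ x| ≤ K` by the mean value inequality between `-y` and `y`
  have hmvt : ‖F₁ y - F₁ (-y)‖ ≤ K * ‖y - -y‖ :=
    (convex_closedBall (0 : V3) (Real.exp 1)).norm_image_sub_le_of_norm_fderiv_le
      (fun z _ => (hF₁.differentiable (by simp)) z) hK hnyB hyB
  have hdiff : F₁ y - F₁ (-y) = (2 * f₁ x) • y := by
    rw [hFy, hFny, sub_neg_eq_add, mul_smul, two_smul]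
  have hdiff' : y - -y = (2 : ℝ) • y := by rw [sub_neg_eq_add, two_smul]
  rw [hdiff, hdiff', norm_smul (2 * f₁ x) y, norm_smul (2 : ℝ) y, hny, Real.norm_eq_abs, Real.norm_eq_abs, abs_mul,
    abs_two] at hmvt
  have hpos : 0 < Real.exp x := Real.exp_pos x
  have h1 : |f₁ x| ≤ K := by
    by_contra hcon
    push Not at hcon
    have := mul_lt_mul_of_pos_right hcon hpos
    nlinarith
  -- `eˣ |f₂ x| ≤ K'` by boundedness of `G₁`
  have h2 : Real.exp x * |f₂ x| ≤ K' := by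
    have h := hK' y hyB
    rw [hGy, Real.norm_eq_abs, abs_mul, abs_of_pos hpos] at h
    exact h
  calc ‖(f₁ x : ℂ)‖ + Real.exp x * ‖(f₂ x : ℂ)‖ = |f₁ x| + Real.exp x * |f₂ x| := by
        rw [Complex.norm_real, Complex.norm_real, Real.norm_eq_abs, Real.norm_eq_abs]
    _ ≤ K + K' := add_le_add h1 h2

/-! ## Real parts of complex centre-regular solutions -/

/-- The componentwise real part of a centre-regular pair is centre-regular: `Re ∘ ŵ`, `Re ∘ ŝ` are `C^∞`, the real radial
fields are the same `F₁`, `G₁`, and the imaginary ones vanish. [folklore] -/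
theorem isRegularPair_re {ŵ ŝ : ℝ → ℂ} (h : IsRegularPair ŵ ŝ) :
    IsRegularPair (fun x => (((ŵ x).re : ℝ) : ℂ)) (fun x => (((ŝ x).re : ℝ) : ℂ)) := by
  obtain ⟨hw, hs, F₁, F₂, G₁, G₂, hF₁, -, hG₁, -, hFG⟩ := h
  refine ⟨?_, ?_, F₁, fun _ => 0, G₁, fun _ => 0, hF₁, contDiff_const, hG₁, contDiff_const, ?_⟩
  · exact Complex.ofRealCLM.contDiff.comp (Complex.reCLM.contDiff.comp hw)
  · exact Complex.ofRealCLM.contDiff.comp (Complex.reCLM.contDiff.comp hs)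
  · intro y hy
    obtain ⟨h1, -, h3, -⟩ := hFG y hy
    refine ⟨?_, ?_, ?_, ?_⟩
    · rw [Complex.ofReal_re]; exact h1
    · rw [Complex.ofReal_im, zero_smul]
    · rw [Complex.ofReal_re]; exact h3
    · rw [Complex.ofReal_im, mul_zero]

/-- `Re` commutes with `d/dx` for differentiable `ŵ : ℝ → ℂ`, in the coerced form used by `linW`/`linS`:
`deriv (x ↦ ((Re ŵ x : ℝ) : ℂ)) = ((Re (deriv ŵ x) : ℝ) : ℂ)`. [folklore] -/
theorem deriv_ofReal_re {ŵ : ℝ → ℂ} (hw : Differentiable ℝ ŵ) (x : ℝ) :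
    deriv (fun y => (((ŵ y).re : ℝ) : ℂ)) x = (((deriv ŵ x).re : ℝ) : ℂ) := by
  have h1 : HasDerivAt (fun y => (ŵ y).re) ((deriv ŵ x).re) x :=
    Complex.reCLM.hasFDerivAt.comp_hasDerivAt x (hw x).hasDerivAt
  exact h1.ofReal_comp.deriv

/-- TAKING REAL PARTS: if a differentiable complex pair `(ŵ, ŝ)` solves `(Λ − L)(ŵ, ŝ) = (f₁, f₂)` with REAL rate `Λ` and REAL
data, then `(Re ŵ, Re ŝ)` solves the same equations (the coefficients of `L = (linW, linS)` are real and `Re` commutes with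
`d/dx`). [folklore] -/
theorem re_solves {r : ℝ} {W S : ℝ → ℝ} {Λ : ℝ} {ŵ ŝ : ℝ → ℂ} {f₁ f₂ : ℝ → ℝ}
    (hw : Differentiable ℝ ŵ) (hs : Differentiable ℝ ŝ)
    (heq : ∀ x, (Λ : ℂ) * ŵ x - linW r W S ŵ ŝ x = (f₁ x : ℂ) ∧ (Λ : ℂ) * ŝ x - linS r W S ŵ ŝ x = (f₂ x : ℂ))
    (x : ℝ) :
    (Λ : ℂ) * (((ŵ x).re : ℝ) : ℂ) -
        linW r W S (fun y => (((ŵ y).re : ℝ) : ℂ)) (fun y => (((ŝ y).re : ℝ) : ℂ)) x = (f₁ x : ℂ) ∧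
      (Λ : ℂ) * (((ŝ x).re : ℝ) : ℂ) -
        linS r W S (fun y => (((ŵ y).re : ℝ) : ℂ)) (fun y => (((ŝ y).re : ℝ) : ℂ)) x = (f₂ x : ℂ) := by
  obtain ⟨h1, h2⟩ := heq x
  have r1 := congrArg Complex.re h1
  have r2 := congrArg Complex.re h2
  simp only [linW, linS, Complex.sub_re, Complex.add_re, Complex.re_ofReal_mul, Complex.ofReal_re] at r1 r2
  unfold linW linS
  rw [deriv_ofReal_re hw, deriv_ofReal_re hs]
  constructor
  · have e1 := congrArg (fun t : ℝ => (t : ℂ)) r1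
    push_cast at e1 ⊢
    linear_combination e1
  · have e2 := congrArg (fun t : ℝ => (t : ℂ)) r2
    push_cast at e2 ⊢
    linear_combination e2

/-! ## The stub -/

/-- **Stub `stub_largeRealResolvent` of line `sonic-cavity-renewal` (merged skeleton v5): THE LARGE-REAL-`Λ` RESOLVENT IS A
COROLLARY OF THE CAVITY RESOLVENT.** From the box package (its rate `Λ₁` and smooth mode instantiate `CavityResolvent`), the
real-part bound (`Re Λ ≤ boxSide = 100` for every smooth radial mode) and the cavity resolvent: with `Λ₀ := 101 + |Λ₁| + |r|`,
for every real `Λ ≥ Λ₀` (i) there is no smooth radial mode at `Λ`, and (ii) every smooth centre-regular real source has a smooth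
centre-regular real solution of `(Λ − L)u = f` — the real part of the complex solution delivered by `CavityResolvent` (the source's
weighted sup is finite by `weightedSup_of_isRegularPair`; the constraints `Re Λ ≥ −1/5`, `‖Λ‖, ‖Λ − Λ₁‖, ‖Λ − r‖ ≥ 1/20` are
automatic). [folklore] -/
theorem stub_largeRealResolvent :
    ∀ (r : ℝ) (W S : ℝ → ℝ), BoxPackage r W S → RealBound r W S → CavityResolvent r W S → LargeRealResolvent r W S := by
  intro r W S hbox hre hres
  obtain ⟨Λ₁, h6, h9, hmode, -, -, -, -⟩ := hbox
  obtain ⟨C, -, hsolve⟩ := hres Λ₁ h6 h9 hmode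
  refine ⟨101 + |Λ₁| + |r|, fun Λ hΛ => ⟨fun ŵ ŝ hm => ?_, fun f₁ f₂ hf => ?_⟩⟩
  · -- (i) exclusion: `Re Λ ≤ boxSide = 100 < 101 ≤ Λ`
    have h := hre (Λ : ℂ) ŵ ŝ hm
    rw [Complex.ofReal_re] at h
    have hb : boxSide = 100 := rfl
    linarith [abs_nonneg Λ₁, abs_nonneg r]
  · -- (ii) solvability: real part of the cavity-resolvent solution
    obtain ⟨N, hN⟩ := weightedSup_of_isRegularPair hf
    have hΛ0 : (101 : ℝ) ≤ Λ := by linarith [abs_nonneg Λ₁, abs_nonneg r]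
    have hΛ1 : (1 : ℝ) ≤ Λ - Λ₁ := by linarith [le_abs_self Λ₁, abs_nonneg r]
    have hΛr : (1 : ℝ) ≤ Λ - r := by linarith [le_abs_self r, abs_nonneg Λ₁]
    obtain ⟨ŵ, ŝ, hreg, heq, -, -⟩ := hsolve (Λ : ℂ) (by rw [Complex.ofReal_re]; linarith)
      (by rw [Complex.norm_of_nonneg (by linarith)]; linarith)
      (by rw [← Complex.ofReal_sub, Complex.norm_of_nonneg (by linarith)]; linarith)
      (by rw [← Complex.ofReal_sub, Complex.norm_of_nonneg (by linarith)]; linarith)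
      (fun x => (f₁ x : ℂ)) (fun x => (f₂ x : ℂ)) hf N hN
    exact ⟨fun x => (ŵ x).re, fun x => (ŝ x).re, isRegularPair_re hreg, fun x =>
      re_solves (hreg.1.differentiable (by simp)) (hreg.2.1.differentiable (by simp)) heq x⟩

end Summit.AtomisticToContinuum.HydrodynamicLimit.Theorems.PackingAnalyticImplosion

end
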